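import Literature.Analysis.FluidPDE.AdditiveNoiseCharacteristics
import Literature.Analysis.ODE.MeasurablePicardLindelof
import HarnessLib

/-!
# Joint measurability of the noisy Lagrangian flow in the initial point and the noise
(JS24 Def. 2.6: `(x, ω) ↦ X^κ_{T,t}(x, ω)` is a measurable random map)

Topic `Literature/Analysis/FluidPDE` (theorems only). For the pathwise noisy characteristics of
`AdditiveNoiseCharacteristics` (Johansson–Sorella, arXiv:2409.03599, Def. 2.6: additive noise, so
for each sample `ω` an ODE driven by the continuous path `w ω`), the solution value is jointly
measurable in the initial point and the sample when `(ω, t) ↦ w ω t` is jointly measurable: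

* `Torus.exists_measurable_noisySolution` — a version `Z (y, ω) t` of the solutions of
  `Z' = u(t, Z + w ω t - w ω t₀)`, `Z (y, ω) t₀ = y`, measurable in `(y, ω)` for every `t`: the
  Picard–Lindelöf solution with parameter `(y, ω)` (initial point moved into the field,
  `Literature.Analysis.ODE.measurable_picardSolution`; the field is made globally measurable in
  time by clamping the time of `u` to `[a,b]`, which does not change it on `[a,b]`).
* `Torus.measurable_noisyFlow_torus` — for ANY solution families `Y ω` and torus maps `φ ω s`
  with `φ ω s (proj y) = proj (Y ω y s + w ω s - w ω t₀)` (e.g. those of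
  `Torus.exists_noisyFlow` / `Torus.exists_measurePreserving_noisyFlow`, chosen per sample), the
  map `(x, ω) ↦ φ ω s x` is measurable on `T^d × Ω` (uniqueness of characteristics identifies
  `Y ω (repr x) s` with the measurable version).

## References

* C. J. P. Johansson, M. Sorella, arXiv:2409.03599v2 (2024), Def. 2.6, p. 9. [`JohanssonSorella2024`]
* D. W. Stroock, S. R. S. Varadhan, *Multidimensional Diffusion Processes* (1979), §1.1
  (measurable dependence of ODE solutions on parameters). [folklore]
-/

noncomputable section

open MeasureTheory Set Filter Metric Function
open scoped NNReal ENNReal Topology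

namespace Literature.Analysis.FluidPDE

namespace Torus

open FunctionSpaces FunctionSpaces.Torus Literature.Analysis.ODE

variable {d : Type*} [Fintype d] {Ω : Type*} [MeasurableSpace Ω]
  {a b t₀ : ℝ} {u : ℝ → UnitAddTorus d → EuclideanSpace ℝ d} {w : Ω → ℝ → EuclideanSpace ℝ d}

/-- The time clamp `t ↦ max a (min t b)` maps into `[a,b]` (for `a ≤ b`) and fixes `[a,b]`.
[folklore] -/
theorem clamp_mem_Icc (hab : a ≤ b) (t : ℝ) : max a (min t b) ∈ Icc a b :=
  ⟨le_max_left _ _, max_le hab (min_le_right _ _)⟩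

omit [MeasurableSpace Ω] in
/-- The space–time lift with clamped time, `(t, z) ↦ u(max a (min t b), proj z)`, is continuous
on `ℝ × ℝ^d` for `u` jointly smooth on `[a,b] × T^d`. [folklore] -/
theorem continuous_stLift_clamp (hab : a ≤ b) (hu : IsSmoothSpaceTimeOn (Icc a b) u) :
    Continuous fun p : ℝ × EuclideanSpace ℝ d => lift (u (max a (min p.1 b))) p.2 := by
  have hc := hu.continuousOn_stLift
  have h2 : Continuous fun p : ℝ × EuclideanSpace ℝ d =>
      ((max a (min p.1 b), p.2) : ℝ × EuclideanSpace ℝ d) :=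
    (continuous_const.max (continuous_fst.min continuous_const)).prodMk continuous_snd
  have h := hc.comp_continuous h2 fun p => mk_mem_prod (clamp_mem_Icc hab p.1) (mem_univ _)
  exact h

/-- **A jointly measurable version of the noisy characteristics.** Let `u` be jointly smooth on
`[a,b] × T^d` with `K`-Lipschitz lifts, `t₀ ∈ [a,b]`, and `w : Ω → ℝ → ℝ^d` with every path
continuous on `[a,b]` and `(ω, t) ↦ w ω t` jointly measurable. Then there is
`Z : ℝ^d × Ω → ℝ → ℝ^d` with `Z (y, ω) t₀ = y`,
`Z (y, ω)' = u(t, Z (y, ω) + w ω t - w ω t₀)` within `[a,b]`, and `(y, ω) ↦ Z (y, ω) t` measurable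
for every `t` (Picard–Lindelöf with the parameter `(y, ω)`, the initial point translated into the
field; `Literature.Analysis.ODE.measurable_picardSolution`).
[cite: JohanssonSorella2024, Def. 2.6, p. 9] -/
theorem exists_measurable_noisySolution (hu : IsSmoothSpaceTimeOn (Icc a b) u) {K : ℝ≥0}
    (hK : ∀ s ∈ Icc a b, LipschitzWith K (lift (u s))) (ht₀ : t₀ ∈ Icc a b)
    (hwc : ∀ ω, ContinuousOn (w ω) (Icc a b)) (hwm : Measurable fun p : Ω × ℝ => w p.1 p.2) :
    ∃ Z : EuclideanSpace ℝ d × Ω → ℝ → EuclideanSpace ℝ d,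
      (∀ p, Z p t₀ = p.1) ∧
      (∀ p, ∀ s ∈ Icc a b,
        HasDerivWithinAt (Z p) (lift (u s) (Z p s + (w p.2 s - w p.2 t₀))) (Icc a b) s) ∧
      ∀ t, Measurable fun p => Z p t := by
  have hab : a ≤ b := ht₀.1.trans ht₀.2
  obtain ⟨M, hM⟩ := hu.exists_norm_le_of_isCompact isCompact_Icc subset_rfl
  have hM0 : 0 ≤ M := (norm_nonneg _).trans (hM t₀ ht₀ 0)
  set L : ℝ≥0 := ⟨M, hM0⟩ with hL
  set R : ℝ≥0 := ⟨M * (b - a), mul_nonneg hM0 (sub_nonneg.2 hab)⟩ with hR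
  -- the parametrised, time-clamped field with the initial point moved into the field
  set F : EuclideanSpace ℝ d × Ω → ℝ → EuclideanSpace ℝ d → EuclideanSpace ℝ d :=
    fun p t z => lift (u (max a (min t b))) (z + p.1 + (w p.2 t - w p.2 t₀)) with hF
  have hFeq : ∀ p, ∀ t ∈ Icc a b, ∀ z, F p t z = lift (u t) (z + p.1 + (w p.2 t - w p.2 t₀)) := by
    intro p t ht z
    simp only [hF, min_eq_left ht.2, max_eq_right ht.1]
  have hPL : ∀ p, IsPicardLindelof (F p) (⟨t₀, ht₀⟩ : Icc a b) 0 R 0 L K := by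
    intro p
    refine ⟨fun s hs => ?_, fun z _ => ?_, fun s hs z _ => ?_, ?_⟩
    · refine (LipschitzWith.lipschitzOnWith ?_)
      intro z z'
      rw [hFeq p s hs, hFeq p s hs]
      have h := hK s hs (z + p.1 + (w p.2 s - w p.2 t₀)) (z' + p.1 + (w p.2 s - w p.2 t₀))
      rwa [edist_add_right, edist_add_right] at h
    · -- continuity in time on `[a,b]`
      have hc := hu.continuousOn_stLift
      have h2 : ContinuousOn (fun s : ℝ =>
          ((s, z + p.1 + (w p.2 s - w p.2 t₀)) : ℝ × EuclideanSpace ℝ d)) (Icc a b) :=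
        continuousOn_id.prodMk (continuousOn_const.add ((hwc p.2).sub continuousOn_const))
      have h := hc.comp h2 fun s hs => mk_mem_prod hs (mem_univ _)
      refine h.congr fun s hs => ?_
      simp only [comp_apply, hFeq p s hs]
      rfl
    · rw [hFeq p s hs]
      exact hM s hs (proj _)
    · rw [NNReal.coe_zero, sub_zero]
      change M * max (b - t₀) (t₀ - a) ≤ M * (b - a)
      exact mul_le_mul_of_nonneg_left (max_le (by linarith [ht₀.1]) (by linarith [ht₀.2])) hM0
  have hx : (0 : EuclideanSpace ℝ d) ∈ closedBall (0 : EuclideanSpace ℝ d) ((0 : ℝ≥0) : ℝ) := by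
    simp
  -- joint measurability of the field
  have hmeas : Measurable fun q : (EuclideanSpace ℝ d × Ω) × ℝ × EuclideanSpace ℝ d =>
      F q.1 q.2.1 q.2.2 := by
    have h1 : Continuous fun r : ℝ × EuclideanSpace ℝ d => lift (u (max a (min r.1 b))) r.2 :=
      continuous_stLift_clamp hab hu
    have h2 : Measurable fun q : (EuclideanSpace ℝ d × Ω) × ℝ × EuclideanSpace ℝ d =>
        ((q.2.1, q.2.2 + q.1.1 + (w q.1.2 q.2.1 - w q.1.2 t₀)) : ℝ × EuclideanSpace ℝ d) := by
      refine measurable_snd.fst.prodMk ?_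
      refine (measurable_snd.snd.add measurable_fst.fst).add ?_
      have hw1 : Measurable fun q : (EuclideanSpace ℝ d × Ω) × ℝ × EuclideanSpace ℝ d =>
          w q.1.2 q.2.1 := hwm.comp (measurable_fst.snd.prodMk measurable_snd.fst)
      have hw2 : Measurable fun q : (EuclideanSpace ℝ d × Ω) × ℝ × EuclideanSpace ℝ d =>
          w q.1.2 t₀ := hwm.comp (measurable_fst.snd.prodMk measurable_const)
      exact hw1.sub hw2
    exact h1.measurable.comp h2
  -- the solution and its translate
  set Z₀ := picardSolution hPL hx with hZ₀
  refine ⟨fun p t => Z₀ p t + p.1, fun p => ?_, fun p s hs => ?_, fun t => ?_⟩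
  · simp only [hZ₀, (picardSolution_spec hPL hx p).1, zero_add]
  · have h := ((picardSolution_spec hPL hx p).2 s hs).add_const p.1
    rw [hFeq p s hs] at h
    simpa only [hZ₀, add_assoc] using h
  · exact (measurable_picardSolution hPL hx hmeas t).add measurable_fst

/-- **Joint measurability of the noisy flow maps on `T^d`.** Let `u`, `t₀`, `w` be as in
`exists_measurable_noisySolution` (`a < b`), and for every sample `ω` let `Y ω` be ANY family of
solutions of `Y' = u(t, Y + w ω t - w ω t₀)` within `[a,b]` with `Y ω y t₀ = y`, and `φ ω s` torus
maps with `φ ω s (proj y) = proj (Y ω y s + w ω s - w ω t₀)` (e.g. chosen per sample from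
`Torus.exists_noisyFlow`). Then `(x, ω) ↦ φ ω s x` is measurable on `T^d × Ω` for every
`s ∈ [a,b]`: by uniqueness of characteristics `Y ω (repr x) s` is the jointly measurable version.
[cite: JohanssonSorella2024, Def. 2.6, p. 9] -/
theorem measurable_noisyFlow_torus [DecidableEq d] (hab : a < b)
    (hu : IsSmoothSpaceTimeOn (Icc a b) u) (ht₀ : t₀ ∈ Icc a b)
    (hwc : ∀ ω, ContinuousOn (w ω) (Icc a b)) (hwm : Measurable fun p : Ω × ℝ => w p.1 p.2)
    {Y : Ω → EuclideanSpace ℝ d → ℝ → EuclideanSpace ℝ d} (hY0 : ∀ ω y, Y ω y t₀ = y)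
    (hY : ∀ ω y, ∀ s ∈ Icc a b,
      HasDerivWithinAt (Y ω y) (lift (u s) (Y ω y s + (w ω s - w ω t₀))) (Icc a b) s)
    {φ : Ω → ℝ → UnitAddTorus d → UnitAddTorus d}
    (hφ : ∀ ω, ∀ s ∈ Icc a b, ∀ y, φ ω s (proj y) = proj (Y ω y s + (w ω s - w ω t₀)))
    {s : ℝ} (hs : s ∈ Icc a b) :
    Measurable fun p : UnitAddTorus d × Ω => φ p.2 s p.1 := by
  obtain ⟨K, hK⟩ := exists_lipschitzWith_lift_of_isSmoothSpaceTimeOn hab hu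
  obtain ⟨Z, hZ0, hZ, hZm⟩ := exists_measurable_noisySolution hu hK ht₀ hwc hwm
  -- identify `Y ω y` with `Z (y, ω)` by uniqueness
  have hYZ : ∀ ω y, Y ω y s = Z (y, ω) s := fun ω y =>
    noisyCharacteristic_unique (w := w ω) hK (hY ω y) (hZ (y, ω)) ht₀
      (by rw [hY0, hZ0]) hs
  have hrepr : ∀ p : UnitAddTorus d × Ω,
      φ p.2 s p.1 = proj (Z (repr p.1, p.2) s + (w p.2 s - w p.2 t₀)) := by
    intro p
    conv_lhs => rw [← proj_repr p.1]
    rw [hφ p.2 s hs, hYZ]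
  simp_rw [hrepr]
  refine measurable_proj.comp ((( hZm s).comp (measurable_repr.comp measurable_fst |>.prodMk
    measurable_snd)).add ?_)
  have hw1 : Measurable fun p : UnitAddTorus d × Ω => w p.2 s :=
    hwm.comp (measurable_snd.prodMk measurable_const)
  have hw2 : Measurable fun p : UnitAddTorus d × Ω => w p.2 t₀ :=
    hwm.comp (measurable_snd.prodMk measurable_const)
  exact hw1.sub hw2

end Torus

end Literature.Analysis.FluidPDE

end
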